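import Mathlib
import Literature.Barriers.ValiantsHypothesis.AlgebraicNaturalProofs
import Literature.Computability.AlgebraicComplexity.ArithCircuitProofs
import Summits.ValiantsHypothesis.ValiantsHypothesis.Theorems.BarrierLeverPartitionMinorsHitByVPAutomorphicLayouts
import Summits.ValiantsHypothesis.ValiantsHypothesis.Theorems.BarrierLeverPartitionMinorsHitByVPCellDoor

/-!
# Route BarrierLever — item `PartitionMinorsHitByVP` (stmt-ValiantsHypothesis-19717):
# AUTOMORPHIC CELLS and the first class that needs cells — UNIONS OF DISJOINT SUBCUBES

Helper file (`--supports stmt-ValiantsHypothesis-19717`; cell valiant-natproofs, rung V4, 𝒟-side,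
prover seat val-np-p6 gen 2). Definition-free, outside the theses cone (no route-file import).
Closes NO item.

* **`partitionMinor_hit_of_automorphicCells`** (CONDITIONAL-FREE DOOR, `b = c + 3`, `h ≥ 1`):
  `m ≤ (h+h)^c` power-diagram cells (`…StrataDoor.partitionMinor_hit_of_cells_perm`, p475102: rows
  by the strict argmax of affine scores `kr t + Σ_{a∈u i} lam t a`, columns by the strict argmax of
  `kc t + Σ_{c∈w j} mu t c`, row cell `t` carried onto column cell `t` by a permutation `e`), cell
  `t` AUTOMORPHIC under its own cube automorphism — `w (e i) = σ_t((u i) ∆ S_t)` — ⇒ hit inside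
  `SmallCircuits ℂ (h+h) (c+3)`. The interval case is `…partitionMinor_hit_of_automorphicStrata`
  (p448961).
* **`partitionMinor_hit_of_disjointSubcubes`** (UNCONDITIONAL CLASS, `b = c + 3`, `h ≥ 1`): rows =
  the union of `m ≤ (h+h)^c` pairwise SEPARATED subcubes `Q_t = [A_t, B_t] = {S : A_t ⊆ S ⊆ B_t}`
  (separated = some coordinate is fixed to `1` in one and to `0` in the other, i.e. disjoint),
  columns = the union of `m` pairwise separated subcubes `Q'_t = [A'_t, B'_t]`, with a bijection
  `σ_t` of coordinates identifying the free coordinates `B_t ∖ A_t` of `Q_t` with those of `Q'_t`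
  (equal dimensions) ⇒ hit inside `SmallCircuits ℂ (h+h) (c+3)`. These are the DISJOINT-DNF
  families (leaves of a decision tree); the cells are cut out by the affine scores
  `−dist(S, Q_t) = −#(A_t ∖ S) − #(S ∖ B_t)` (value `0` on `Q_t`, `≤ −1` on every other subcube of
  the family), and cell `t` is automorphic under `(σ_t, A_t ∆ σ_t⁻¹(A'_t))`.
  WHY CELLS AND NOT INTERVALS: already for `h = 3` the separated subcubes `Q₁ = {x₁=0,x₃=0}`,
  `Q₂ = {x₁=1,x₂=0}`, `Q₃ = {x₂=1,x₃=1}` lie in distinct intervals of NO linear functional `λ`: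
  the value pairs `(0 | λ₁+λ₂+λ₃) ∈ Q₁×Q₃`, `(λ₂ | λ₁+λ₃) ∈ Q₁×Q₂`, `(λ₂+λ₃ | λ₁) ∈ Q₃×Q₂` have the
  same sum, while for intervals `I_a < I_b < I_c` a pair from `I_a × I_b` has a smaller sum than a
  pair from `I_b × I_c` — so the m-strata door p448281 (one threshold pair) does not produce these
  cells, and the power-diagram form of the door is what this class uses.

WHAT THIS IS NOT: a structured class; nothing on generic layouts / the middle band `r ≈ 2^{h/2}`,
on TT / item 19616 / 19761, on crux 14610 or on VP vs VNP.
-/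

set_option linter.dupNamespace false

namespace Summit.ValiantsHypothesis.ValiantsHypothesis.Theorems.BarrierLever.StrataDoor

open Finset
open Literature.Barriers.ValiantsHypothesis Literature.Computability.AlgebraicComplexity
open Summit.ValiantsHypothesis.ValiantsHypothesis.Theorems.BarrierLever.Automorphic
  (coeff_twistedDiag twistedDiag_mem_smallCircuits)

variable {h r : ℕ}

/-! ## 1. Automorphic cells -/

/-- An automorphic cell (`w (e i) = σ((u i) ∆ s)` for the rows `i` of the cell cut out by a
predicate `p`) has the identity as its cell matrix at the twisted diagonal state `f_{(σ,s)}`; in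
particular it is nonsingular. (Predicate form of `…cell_det_twistedDiag_ne_zero'`.) -/
theorem cell_det_twistedDiag_ne_zero_pred (u w : Fin r → Finset (Fin h)) (hu : Function.Injective u)
    (p : Fin r → Prop) [DecidablePred p] (e : Equiv.Perm (Fin r)) (σ : Equiv.Perm (Fin h))
    (s : Finset (Fin h)) (hw : ∀ i : {i // p i}, w (e i.1) = (symmDiff (u i.1) s).image σ) :
    (Matrix.of fun i i' : {i // p i} => MvPolynomial.coeff
        (∑ a ∈ u i.1, Finsupp.single (Fin.castAdd h a) 1 +
          ∑ c ∈ w (e i'.1), Finsupp.single (Fin.natAdd h c) 1)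
        (∏ a : Fin h, (if a ∈ s then MvPolynomial.X (Fin.natAdd h (σ a)) + MvPolynomial.X (Fin.castAdd h a)
          else 1 + MvPolynomial.X (Fin.castAdd h a) * MvPolynomial.X (Fin.natAdd h (σ a))) :
          MvPolynomial (Fin (h + h)) ℂ)).det ≠ 0 := by
  classical
  have hinj : ∀ A B : Finset (Fin h), (symmDiff A s).image σ = (symmDiff B s).image σ ↔ A = B := by
    intro A B
    constructor
    · intro hAB
      have h1 : symmDiff A s = symmDiff B s := (Finset.image_injective σ.injective) hAB
      simpa [symmDiff_left_inj] using congrArg (fun C => symmDiff C s) h1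
    · rintro rfl
      rfl
  have hM : (Matrix.of fun i i' : {i // p i} => MvPolynomial.coeff
        (∑ a ∈ u i.1, Finsupp.single (Fin.castAdd h a) 1 +
          ∑ c ∈ w (e i'.1), Finsupp.single (Fin.natAdd h c) 1)
        (∏ a : Fin h, (if a ∈ s then MvPolynomial.X (Fin.natAdd h (σ a)) + MvPolynomial.X (Fin.castAdd h a)
          else 1 + MvPolynomial.X (Fin.castAdd h a) * MvPolynomial.X (Fin.natAdd h (σ a))) :
          MvPolynomial (Fin (h + h)) ℂ)) = 1 := by
    ext i i'
    rw [Matrix.of_apply, coeff_twistedDiag, hw i', Matrix.one_apply]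
    simp only [hinj, hu.eq_iff]
    by_cases hii : i = i'
    · subst hii
      simp
    · rw [if_neg (fun hh => hii (Subtype.ext hh).symm), if_neg hii]
  rw [hM, Matrix.det_one]
  exact one_ne_zero

/-- Arithmetic of the size budget for automorphic cells: `m·((h+h)^2 + (h+h) + 2) ≤ (h+h)^(c+3)`
for `m ≤ (h+h)^c`, `h ≥ 1`. -/
theorem automorphicCells_budget (c m : ℕ) (hh : 1 ≤ h) (hm : m ≤ (h + h) ^ c) :
    m * ((h + h) ^ 2 + (h + h) + 2) ≤ (h + h) ^ (c + 3) := by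
  have hpk : (h + h) + 2 ≤ (h + h) ^ 2 := by nlinarith
  calc m * ((h + h) ^ 2 + (h + h) + 2) ≤ (h + h) ^ c * ((h + h) ^ 2 + (h + h) + 2) :=
        Nat.mul_le_mul_right _ hm
    _ ≤ (h + h) ^ c * ((h + h) ^ 2 + (h + h) ^ 2) := by
        apply Nat.mul_le_mul_left
        omega
    _ = (h + h) ^ c * (2 * (h + h) ^ 2) := by ring
    _ ≤ (h + h) ^ c * ((h + h) * (h + h) ^ 2) := by gcongr; omega
    _ = (h + h) ^ (c + 3) := by ring

/-- **Automorphic cells are hit** (`b = c + 3`, `h ≥ 1`): `m ≤ (h+h)^c` power-diagram cells (strict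
argmax of affine scores on each side, row cell `t` carried onto column cell `t` by `e`), cell `t`
automorphic under its own cube automorphism `(σ t, S t)` — `w (e i) = σ_{lr i}((u i) ∆ S_{lr i})` —
⇒ some `f ∈ SmallCircuits ℂ (h+h) (c+3)` makes the layout matrix of item 19717 nonsingular. -/
theorem partitionMinor_hit_of_automorphicCells (c m : ℕ) (hh : 1 ≤ h) (hm : m ≤ (h + h) ^ c)
    (u w : Fin r → Finset (Fin h)) (hu : Function.Injective u)
    (lam mu : ℕ → Fin h → ℤ) (kr kc : ℕ → ℤ) (lr lc : Fin r → ℕ) (e : Equiv.Perm (Fin r))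
    (he : ∀ i, lc (e i) = lr i) (hlr : ∀ i, lr i < m)
    (hrow : ∀ i, ∀ t < m, t ≠ lr i →
      kr t + ∑ a ∈ u i, lam t a < kr (lr i) + ∑ a ∈ u i, lam (lr i) a)
    (hcol : ∀ j, ∀ t < m, t ≠ lc j →
      kc t + ∑ c ∈ w j, mu t c < kc (lc j) + ∑ c ∈ w j, mu (lc j) c)
    (σ : ℕ → Equiv.Perm (Fin h)) (S : ℕ → Finset (Fin h))
    (hw : ∀ i, w (e i) = (symmDiff (u i) (S (lr i))).image (σ (lr i))) :
    ∃ f ∈ SmallCircuits ℂ (h + h) (c + 3),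
      (Matrix.of fun i j : Fin r => MvPolynomial.coeff
        (∑ a ∈ u i, Finsupp.single (Fin.castAdd h a) 1 +
          ∑ c ∈ w j, Finsupp.single (Fin.natAdd h c) 1) f).det ≠ 0 := by
  classical
  set F : ℕ → MvPolynomial (Fin (h + h)) ℂ := fun t =>
    ∏ a : Fin h, (if a ∈ S t then MvPolynomial.X (Fin.natAdd h (σ t a)) + MvPolynomial.X (Fin.castAdd h a)
      else 1 + MvPolynomial.X (Fin.castAdd h a) * MvPolynomial.X (Fin.natAdd h (σ t a))) with hF
  have hFsc : ∀ t, F t ∈ SmallCircuits ℂ (h + h) 2 := fun t => twistedDiag_mem_smallCircuits hh (σ t) (S t)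
  obtain ⟨f, hdeg, hsize, hne⟩ := partitionMinor_hit_of_cells_perm m u w lam mu kr kc lr lc e he hlr
    hrow hcol F (fun t _ =>
      cell_det_twistedDiag_ne_zero_pred u w hu (fun i => lr i = t) e (σ t) (S t)
        (fun i => by rw [hw i.1, i.2]))
  refine ⟨f, ⟨?_, ?_⟩, hne⟩
  · exact hdeg.trans (Finset.sup_le fun t _ => (hFsc t).1)
  · refine hsize.trans ?_
    calc ∑ t ∈ Finset.range m, complexity (F t) + m * (h + h + 2)
        ≤ ∑ _t ∈ Finset.range m, (h + h) ^ 2 + m * (h + h + 2) := by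
          gcongr with t _
          exact (hFsc t).2
      _ = m * ((h + h) ^ 2 + (h + h) + 2) := by
          rw [Finset.sum_const, Finset.card_range, smul_eq_mul]; ring
      _ ≤ (h + h) ^ (c + 3) := automorphicCells_budget c m hh hm

/-! ## 2. The subcube score `−dist(S, [A, B])` -/

/-- The subcube score: `Σ_{a ∈ S} ([a ∈ A] − [a ∉ B]) = #(S ∩ A) − #(S ∖ B)`. -/
theorem sum_subcubeScore (S A B : Finset (Fin h)) :
    (∑ a ∈ S, ((if a ∈ A then (1 : ℤ) else 0) - (if a ∉ B then (1 : ℤ) else 0))) =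
      ((S ∩ A).card : ℤ) - ((S \ B).card : ℤ) := by
  classical
  rw [Finset.sum_sub_distrib, Finset.sum_boole, Finset.sum_boole, Finset.filter_mem_eq_inter,
    ← Finset.sdiff_eq_filter]

/-- On its own subcube the score `−#A + #(S ∩ A) − #(S ∖ B)` vanishes. -/
theorem subcubeScore_self (S A B : Finset (Fin h)) (hA : A ⊆ S) (hB : S ⊆ B) :
    -(A.card : ℤ) + (((S ∩ A).card : ℤ) - ((S \ B).card : ℤ)) = 0 := by
  rw [Finset.inter_eq_right.mpr hA, Finset.sdiff_eq_empty_iff_subset.mpr hB, Finset.card_empty]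
  push_cast
  ring

/-- On a SEPARATED subcube the score is negative: if `A ⊆ S ⊆ B` and some coordinate is fixed to
`1` in one of `[A, B]`, `[A', B']` and to `0` in the other, then `−#A' + #(S ∩ A') − #(S ∖ B') < 0`. -/
theorem subcubeScore_lt (S A B A' B' : Finset (Fin h)) (hA : A ⊆ S) (hB : S ⊆ B)
    (hsep : ∃ a, (a ∈ A ∧ a ∉ B') ∨ (a ∈ A' ∧ a ∉ B)) :
    -(A'.card : ℤ) + (((S ∩ A').card : ℤ) - ((S \ B').card : ℤ)) < 0 := by
  classical
  have hle : (S ∩ A').card ≤ A'.card := Finset.card_le_card Finset.inter_subset_right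
  obtain ⟨a, ⟨haA, haB'⟩ | ⟨haA', haB⟩⟩ := hsep
  · -- `a ∈ S ∖ B'`
    have h1 : 1 ≤ (S \ B').card :=
      Finset.card_pos.mpr ⟨a, Finset.mem_sdiff.mpr ⟨hA haA, haB'⟩⟩
    have h1' : (1 : ℤ) ≤ ((S \ B').card : ℤ) := by exact_mod_cast h1
    have hle' : ((S ∩ A').card : ℤ) ≤ (A'.card : ℤ) := by exact_mod_cast hle
    linarith
  · -- `a ∈ A' ∖ S`
    have haS : a ∉ S := fun h' => haB (hB h')
    have h2 : (S ∩ A').card < A'.card := by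
      refine Finset.card_lt_card ⟨Finset.inter_subset_right, fun hsub => ?_⟩
      exact haS (Finset.mem_inter.mp (hsub haA')).1
    have h2' : ((S ∩ A').card : ℤ) < (A'.card : ℤ) := by exact_mod_cast h2
    have h0 : (0 : ℤ) ≤ ((S \ B').card : ℤ) := by positivity
    linarith

/-! ## 3. The automorphism carrying one subcube onto another of the same dimension -/

/-- If `σ` identifies the free coordinates of `[A, B]` with those of `[A', B']` (`A' ⊆ B'`), then
`S ↦ σ(S ∆ (A ∆ σ⁻¹ A'))` carries `[A, B]` into `[A', B']`. -/
theorem image_symmDiff_mem_subcube (A B A' B' S : Finset (Fin h)) (σ : Equiv.Perm (Fin h))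
    (hAB' : A' ⊆ B') (hσ : ∀ a, (a ∈ B ∧ a ∉ A) ↔ (σ a ∈ B' ∧ σ a ∉ A'))
    (hA : A ⊆ S) (hB : S ⊆ B) :
    A' ⊆ (symmDiff S (symmDiff A (A'.image ⇑σ.symm))).image σ ∧
      (symmDiff S (symmDiff A (A'.image ⇑σ.symm))).image σ ⊆ B' := by
  classical
  -- membership criterion: `b ∈ g(S) ↔ (σ⁻¹ b ∈ S ∖ A) xor (b ∈ A')`
  have hmem : ∀ b, b ∈ (symmDiff S (symmDiff A (A'.image ⇑σ.symm))).image σ ↔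
      ((σ.symm b ∈ S ∧ σ.symm b ∉ A) ↔ b ∉ A') := by
    intro b
    rw [Finset.mem_image]
    constructor
    · rintro ⟨a, ha, rfl⟩
      rw [Equiv.symm_apply_apply]
      rw [Finset.mem_symmDiff, Finset.mem_symmDiff, Finset.mem_image] at ha
      have hiff : (∃ x ∈ A', σ.symm x = a) ↔ σ a ∈ A' := by
        constructor
        · rintro ⟨x, hx, hxa⟩
          rw [← hxa, Equiv.apply_symm_apply]; exact hx
        · intro hx
          exact ⟨σ a, hx, Equiv.symm_apply_apply _ _⟩
      rw [hiff] at ha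
      have haA : a ∈ A → a ∈ S := fun h' => hA h'
      tauto
    · intro hb
      refine ⟨σ.symm b, ?_, Equiv.apply_symm_apply _ _⟩
      rw [Finset.mem_symmDiff, Finset.mem_symmDiff, Finset.mem_image]
      have hiff : (∃ x ∈ A', σ.symm x = σ.symm b) ↔ b ∈ A' := by
        constructor
        · rintro ⟨x, hx, hxa⟩
          rw [σ.symm.injective hxa] at hx; exact hx
        · intro hx
          exact ⟨b, hx, rfl⟩
      rw [hiff]
      have haA : σ.symm b ∈ A → σ.symm b ∈ S := fun h' => hA h'
      tauto
  constructor
  · intro b hb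
    rw [hmem]
    constructor
    · rintro ⟨h1, h2⟩
      -- `σ⁻¹ b` is free in `[A,B]`, so `b` is free in `[A',B']`, contradicting `b ∈ A'`
      have hfree := (hσ (σ.symm b)).mp ⟨hB h1, h2⟩
      rw [Equiv.apply_symm_apply] at hfree
      exact absurd hb hfree.2
    · intro hb'
      exact absurd hb hb'
  · intro b hb
    rw [hmem] at hb
    by_cases hbA' : b ∈ A'
    · exact hAB' hbA'
    · obtain ⟨h1, h2⟩ := hb.mpr hbA'
      have hfree := (hσ (σ.symm b)).mp ⟨hB h1, h2⟩
      rw [Equiv.apply_symm_apply] at hfree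
      exact hfree.1

/-! ## 4. Unions of disjoint subcubes -/

/-- **Unions of pairwise separated subcubes are hit** (`b = c + 3`, `h ≥ 1`). Rows = the union of
`m ≤ (h+h)^c` pairwise separated subcubes `[A_t, B_t]`, columns = the union of `m` pairwise separated
subcubes `[A'_t, B'_t]`, `σ_t` a coordinate permutation identifying the free coordinates of `[A_t, B_t]`
with those of `[A'_t, B'_t]` ⇒ some `f ∈ SmallCircuits ℂ (h+h) (c+3)` makes the layout matrix of
item 19717 nonsingular (injectivity of `w` and `A_t ⊆ B_t` are not needed as hypotheses: they are
not used, resp. implied by the row family being indexed). The cells are cut out by the scores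
`−dist(·, [A_t, B_t])`, an instance of the cell door that is not an instance of the one-threshold
strata door (module docstring). -/
theorem partitionMinor_hit_of_disjointSubcubes (c m : ℕ) (hh : 1 ≤ h) (hm : m ≤ (h + h) ^ c)
    (u w : Fin r → Finset (Fin h)) (hu : Function.Injective u)
    (A B A' B' : ℕ → Finset (Fin h)) (σ : ℕ → Equiv.Perm (Fin h))
    (hAB' : ∀ t < m, A' t ⊆ B' t)
    (hU : ∀ T : Finset (Fin h), (∃ i, u i = T) ↔ ∃ t < m, A t ⊆ T ∧ T ⊆ B t)
    (hW : ∀ T : Finset (Fin h), (∃ j, w j = T) ↔ ∃ t < m, A' t ⊆ T ∧ T ⊆ B' t)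
    (hsepU : ∀ t < m, ∀ t' < m, t ≠ t' → ∃ a, (a ∈ A t ∧ a ∉ B t') ∨ (a ∈ A t' ∧ a ∉ B t))
    (hsepW : ∀ t < m, ∀ t' < m, t ≠ t' → ∃ a, (a ∈ A' t ∧ a ∉ B' t') ∨ (a ∈ A' t' ∧ a ∉ B' t))
    (hσ : ∀ t < m, ∀ a, (a ∈ B t ∧ a ∉ A t) ↔ (σ t a ∈ B' t ∧ σ t a ∉ A' t)) :
    ∃ f ∈ SmallCircuits ℂ (h + h) (c + 3),
      (Matrix.of fun i j : Fin r => MvPolynomial.coeff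
        (∑ a ∈ u i, Finsupp.single (Fin.castAdd h a) 1 +
          ∑ c ∈ w j, Finsupp.single (Fin.natAdd h c) 1) f).det ≠ 0 := by
  classical
  -- cell labels
  have hrowQ : ∀ i, ∃ t, t < m ∧ A t ⊆ u i ∧ u i ⊆ B t := fun i => by
    obtain ⟨t, ht, h1, h2⟩ := (hU (u i)).mp ⟨i, rfl⟩
    exact ⟨t, ht, h1, h2⟩
  have hcolQ : ∀ j, ∃ t, t < m ∧ A' t ⊆ w j ∧ w j ⊆ B' t := fun j => by
    obtain ⟨t, ht, h1, h2⟩ := (hW (w j)).mp ⟨j, rfl⟩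
    exact ⟨t, ht, h1, h2⟩
  choose lr hlr using hrowQ
  choose lc hlc using hcolQ
  -- uniqueness of the column label
  have hlc_uniq : ∀ j t, t < m → A' t ⊆ w j → w j ⊆ B' t → lc j = t := by
    intro j t ht h1 h2
    by_contra hne
    obtain ⟨a, ⟨ha1, ha2⟩ | ⟨ha1, ha2⟩⟩ := hsepW (lc j) (hlc j).1 t ht hne
    · exact ha2 (h2 ((hlc j).2.1 ha1))
    · exact ha2 ((hlc j).2.2 (h1 ha1))
  -- the automorphic target of a row and the matching permutation
  set s : ℕ → Finset (Fin h) := fun t => symmDiff (A t) ((A' t).image ⇑(σ t).symm) with hs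
  set g : Fin r → Finset (Fin h) := fun i => (symmDiff (u i) (s (lr i))).image (σ (lr i)) with hg
  have hgQ : ∀ i, A' (lr i) ⊆ g i ∧ g i ⊆ B' (lr i) := fun i =>
    image_symmDiff_mem_subcube (A (lr i)) (B (lr i)) (A' (lr i)) (B' (lr i)) (u i) (σ (lr i))
      (hAB' _ (hlr i).1) (hσ _ (hlr i).1) (hlr i).2.1 (hlr i).2.2
  have hgex : ∀ i, ∃ j, w j = g i := fun i =>
    (hW (g i)).mpr ⟨lr i, (hlr i).1, (hgQ i).1, (hgQ i).2⟩
  choose e₀ he₀ using hgex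
  have hlce₀ : ∀ i, lc (e₀ i) = lr i := fun i =>
    hlc_uniq (e₀ i) (lr i) (hlr i).1 (by rw [he₀]; exact (hgQ i).1) (by rw [he₀]; exact (hgQ i).2)
  have hginj : ∀ i i', lr i = lr i' → g i = g i' → u i = u i' := by
    intro i i' hll hgg
    simp only [hg, hll] at hgg
    have h1 : symmDiff (u i) (s (lr i')) = symmDiff (u i') (s (lr i')) :=
      (Finset.image_injective (σ (lr i')).injective) hgg
    simpa [symmDiff_left_inj] using congrArg (fun C => symmDiff C (s (lr i'))) h1
  have he₀inj : Function.Injective e₀ := by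
    intro i i' hii
    have hll : lr i = lr i' := by rw [← hlce₀ i, ← hlce₀ i', hii]
    exact hu (hginj i i' hll (by rw [← he₀ i, ← he₀ i', hii]))
  set e : Equiv.Perm (Fin r) := Equiv.ofBijective e₀ (Finite.injective_iff_bijective.mp he₀inj) with he
  have he_apply : ∀ i, e i = e₀ i := fun i => rfl
  -- scores `−dist(·, Q_t)`
  set lam : ℕ → Fin h → ℤ := fun t a =>
    (if a ∈ A t then (1 : ℤ) else 0) - (if a ∉ B t then (1 : ℤ) else 0) with hlam
  set mu : ℕ → Fin h → ℤ := fun t a =>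
    (if a ∈ A' t then (1 : ℤ) else 0) - (if a ∉ B' t then (1 : ℤ) else 0) with hmu
  refine partitionMinor_hit_of_automorphicCells c m hh hm u w hu lam mu
    (fun t => -((A t).card : ℤ)) (fun t => -((A' t).card : ℤ)) lr lc e
    (fun i => by rw [he_apply, hlce₀]) (fun i => (hlr i).1) (fun i t ht hne => ?_)
    (fun j t ht hne => ?_) σ s (fun i => by rw [he_apply, he₀])
  · -- row strictness
    simp only [hlam]
    rw [sum_subcubeScore, sum_subcubeScore,
      subcubeScore_self (u i) (A (lr i)) (B (lr i)) (hlr i).2.1 (hlr i).2.2]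
    exact subcubeScore_lt (u i) (A (lr i)) (B (lr i)) (A t) (B t) (hlr i).2.1 (hlr i).2.2
      (hsepU (lr i) (hlr i).1 t ht (Ne.symm hne))
  · -- column strictness
    simp only [hmu]
    rw [sum_subcubeScore, sum_subcubeScore,
      subcubeScore_self (w j) (A' (lc j)) (B' (lc j)) (hlc j).2.1 (hlc j).2.2]
    exact subcubeScore_lt (w j) (A' (lc j)) (B' (lc j)) (A' t) (B' t) (hlc j).2.1 (hlc j).2.2
      (hsepW (lc j) (hlc j).1 t ht (Ne.symm hne))

end Summit.ValiantsHypothesis.ValiantsHypothesis.Theorems.BarrierLever.StrataDoor
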